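import Summits.HodgeConjecture.HodgeConjecture.Theorems.PadicSemiregularLiftFermatAnchorAssemblyGMFBaseChange
import Summits.HodgeConjecture.HodgeConjecture.Theorems.PadicSemiregularLiftFermatAnchorAssemblyEulerCochains
import Mathlib.RingTheory.MvPolynomial.Basic
import Mathlib.LinearAlgebra.FiniteDimensional.Basic
import Mathlib.RingTheory.Finiteness.Prod
import Mathlib.LinearAlgebra.Dimension.Finite

/-!
# `stub_rigidLift` (line `witt-lift-rigid-mf`, crux `FermatAnchorAssembly`) · auxiliaries I

Bookkeeping for the vocabulary of
`Theorems/PadicSemiregularLiftFermatAnchorAssemblyGMFDefs.lean` (namespace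
`Summit.HodgeConjecture.HodgeConjecture.Cruxes.FermatAnchorAssembly.WittLiftRigidMf`) used by the proof
of the registered stub `stub_rigidLift` of crux stmt-HodgeConjecture-14874 (helpers in the
sub-namespace `RigidLift`; the closure of `IsBihom` under `0, +, •, −, Σ, ·`, base change and support
shrinking, and the submodules `cochainSub ⊇ closedSub ⊇ nullSub` with carriers
`cochainSet ⊇ closedSet ⊇ nullSet`, are imported from `…GMFBaseChange.lean` / `…EulerCochains.lean`):

* the Fermat form `Σ xᵢᵐ` is bihomogeneous of bidegree `(m, 0)`; products of bihomogeneous matrices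
  and scalar matrices `f • 1` are bihomogeneous with the expected bidegrees;
* `GMFData.cochainSet` spans a FINITE-DIMENSIONAL space over a field (every entry has total degree
  bounded by its prescribed `ℤ`-degree: `Submodule.pi` of `MvPolynomial.restrictTotalDegree`);
* the registered helper sub-goal `closedSet_subset_nullSet_of_isRigid` (H1): for RIGID data `M` over a
  field (`GMFData.IsRigid K L M`, i.e. `finrank (span closed ⧸ span null) = 0`) every closed even
  cochain of twist `m` is null-homotopic — the form in which rigidity is consumed by the lifting step.
-/

-- `Summit.HodgeConjecture.HodgeConjecture.…` is the tree's mandated summit/problem namespace (single-problem summit).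
set_option linter.dupNamespace false

noncomputable section

open Finset

namespace Summit.HodgeConjecture.HodgeConjecture.Cruxes.FermatAnchorAssembly.WittLiftRigidMf

namespace RigidLift

/-! ### Degrees of monomials; bihomogeneity of the Fermat form and of matrix products -/

section Degrees

variable {ν : ℕ}

/-- `|a·eᵢ| = a`. [folklore] -/
theorem zdeg_single (i : Fin ν) (a : ℕ) : zdeg (Finsupp.single i a) = a := by
  simp [zdeg, Finsupp.single_apply]

/-- `m·eᵢ mod m = 0`. [folklore] -/
theorem gdeg_single_self (m : ℕ) (i : Fin ν) : gdeg m (Finsupp.single i m) = 0 := by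
  funext j
  simp only [gdeg, Finsupp.single_apply, Pi.zero_apply]
  split_ifs <;> simp

end Degrees

section IsBihom

variable {R : Type} [CommRing R] {ν m : ℕ} {L : AddSubgroup (Fin ν → ZMod m)}
  {q : MvPolynomial (Fin ν) R} {d d' : ℤ} {c c' : Fin ν → ZMod m}

/-- Transport of bihomogeneity along equal bidegrees. [folklore] -/
theorem isBihom_congr (h : IsBihom m L q d c) (hd : d = d') (hc : c = c') : IsBihom m L q d' c' := by
  subst hd hc
  exact h

/-- A bihomogeneous polynomial of `ℤ`-degree `d` has total degree `≤ d.toNat`. [folklore] -/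
theorem totalDegree_le_of_isBihom (h : IsBihom m L q d c) : q.totalDegree ≤ d.toNat := by
  rw [MvPolynomial.totalDegree, Finset.sup_le_iff]
  intro e he
  obtain ⟨h1, -⟩ := h e he
  simp only [zdeg] at h1
  subst h1
  rw [Int.toNat_natCast, Finsupp.sum_fintype _ _ (fun _ ↦ rfl)]

variable (R L) in
/-- The Fermat form `Σ xᵢᵐ` is bihomogeneous of bidegree `(m, 0)` for every grading subgroup. [folklore] -/
theorem isBihom_fermatForm : IsBihom m L (fermatForm R ν m) (m : ℤ) 0 := by
  classical
  refine IsBihom.sum _ _ fun i _ ↦ ?_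
  intro e he
  rw [MvPolynomial.X_pow_eq_monomial] at he
  have he' := MvPolynomial.support_monomial_subset he
  rw [Finset.mem_singleton] at he'
  subst he'
  exact ⟨zdeg_single i m, by rw [gdeg_single_self, sub_zero]; exact zero_mem L⟩

variable {κ ι o : Type}

/-- Products of bihomogeneous matrices are bihomogeneous; the twists add. Here `X k i` has bidegree
`(dι i − dκ k + t, cι i − cκ k)` and `Y i l` has bidegree `(dο l − dι i + t', cο l − cι i)`. [folklore] -/
theorem isBihom_mul_apply [Fintype ι] {dκ : κ → ℤ} {cκ : κ → Fin ν → ZMod m} {dι : ι → ℤ}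
    {cι : ι → Fin ν → ZMod m} {dο : o → ℤ} {cο : o → Fin ν → ZMod m} {t t' : ℤ}
    {X : Matrix κ ι (MvPolynomial (Fin ν) R)} {Y : Matrix ι o (MvPolynomial (Fin ν) R)}
    (hX : ∀ k i, IsBihom m L (X k i) (dι i - dκ k + t) (cι i - cκ k))
    (hY : ∀ i l, IsBihom m L (Y i l) (dο l - dι i + t') (cο l - cι i)) (k : κ) (l : o) :
    IsBihom m L ((X * Y) k l) (dο l - dκ k + (t + t')) (cο l - cκ k) := by
  rw [Matrix.mul_apply]
  exact IsBihom.sum _ _ fun i _ ↦ (hX k i).mul (hY i l) (by ring) (by abel)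

/-- `f • 1` is bihomogeneous of twist `deg f` for a bihomogeneous `f` of character `0`. [folklore] -/
theorem isBihom_smul_one_apply [DecidableEq κ] {f : MvPolynomial (Fin ν) R} {df : ℤ}
    (hf : IsBihom m L f df 0) (dκ : κ → ℤ) (cκ : κ → Fin ν → ZMod m) (k k' : κ) :
    IsBihom m L ((f • (1 : Matrix κ κ (MvPolynomial (Fin ν) R))) k k') (dκ k' - dκ k + df)
      (cκ k' - cκ k) := by
  rw [Matrix.smul_apply, Matrix.one_apply]
  split_ifs with h
  · subst h
    simpa using hf
  · rw [smul_zero]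
    exact IsBihom.zero

end IsBihom

/-! ### Cochains span a finite-dimensional space; rigidity -/

section Field

variable {K : Type} [Field K] {ν m : ℕ} {ι₀ ι₁ κ₀ κ₁ : Type} [Fintype ι₀] [Fintype ι₁] [Fintype κ₀]
  [Fintype κ₁] (L : AddSubgroup (Fin ν → ZMod m)) (t : ℤ) (M : GMFData K ν m ι₀ ι₁)
  (N : GMFData K ν m κ₀ κ₁)

/-- Closed cochains are cochains. [folklore] -/
theorem closedSet_subset_cochainSet :
    GMFData.closedSet m L t M N ⊆ GMFData.cochainSet m L t M N := fun _ h ↦ h.1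

/-- Over a field the cochains of twist `t` span a FINITE-DIMENSIONAL space: every entry is a
polynomial of total degree at most its prescribed `ℤ`-degree. [folklore] -/
theorem finiteDimensional_span_cochainSet :
    FiniteDimensional K (Submodule.span K (GMFData.cochainSet m L t M N)) := by
  let P₀ : Submodule K (κ₀ → ι₀ → MvPolynomial (Fin ν) K) :=
    Submodule.pi Set.univ fun k ↦ Submodule.pi Set.univ fun i ↦
      MvPolynomial.restrictTotalDegree (Fin ν) K (M.d₀ i - N.d₀ k + t).toNat
  let P₁ : Submodule K (κ₁ → ι₁ → MvPolynomial (Fin ν) K) :=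
    Submodule.pi Set.univ fun l ↦ Submodule.pi Set.univ fun j ↦
      MvPolynomial.restrictTotalDegree (Fin ν) K (M.d₁ j - N.d₁ l + t).toNat
  let W : Submodule K (Matrix κ₀ ι₀ (MvPolynomial (Fin ν) K) × Matrix κ₁ ι₁ (MvPolynomial (Fin ν) K)) :=
    P₀.prod P₁
  have hW : W.FG := by
    refine Submodule.FG.prod (Submodule.fg_pi fun k ↦ Submodule.fg_pi fun i ↦ ?_)
      (Submodule.fg_pi fun l ↦ Submodule.fg_pi fun j ↦ ?_)
    · exact Module.Finite.iff_fg.mp inferInstance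
    · exact Module.Finite.iff_fg.mp inferInstance
  haveI : FiniteDimensional K W := Module.Finite.iff_fg.mpr hW
  refine Submodule.finiteDimensional_of_le (S₂ := W) ?_
  rw [Submodule.span_le]
  rintro ⟨a, b⟩ ⟨ha, hb⟩
  refine Submodule.mem_prod.mpr ⟨?_, ?_⟩
  · exact Submodule.mem_pi.mpr fun k _ ↦ Submodule.mem_pi.mpr fun i _ ↦
      (MvPolynomial.mem_restrictTotalDegree _ _ _).mpr (totalDegree_le_of_isBihom (ha k i))
  · exact Submodule.mem_pi.mpr fun l _ ↦ Submodule.mem_pi.mpr fun j _ ↦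
      (MvPolynomial.mem_restrictTotalDegree _ _ _).mpr (totalDegree_le_of_isBihom (hb l j))

/-- Closed cochains span a finite-dimensional space. [folklore] -/
theorem finiteDimensional_span_closedSet :
    FiniteDimensional K (Submodule.span K (GMFData.closedSet m L t M N)) :=
  haveI := finiteDimensional_span_cochainSet L t M N
  Submodule.finiteDimensional_of_le (Submodule.span_mono (closedSet_subset_cochainSet L t M N))

/-- The span of the null-homotopic cochains is the submodule `nullSub` of `…EulerCochains.lean`. [folklore] -/
theorem span_nullSet_eq :
    Submodule.span K (GMFData.nullSet m L t M N) = GMFData.nullSub L t M N := by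
  rw [← GMFData.coe_nullSub]
  exact Submodule.span_eq _

/-- `Hom(M, N(t)) = 0` (as a `finrank`) iff every closed cochain of twist `t` is null-homotopic —
the `→` direction, the only one used. [folklore] -/
theorem closedSet_subset_nullSet_of_homDim_eq_zero (h : GMFData.homDim K L t M N = 0) :
    GMFData.closedSet m L t M N ⊆ GMFData.nullSet m L t M N := by
  intro ab hab
  haveI := finiteDimensional_span_closedSet L t M N
  have htop := Submodule.Quotient.subsingleton_iff.mp (Module.finrank_zero_iff.mp h)
  have hmem : (⟨ab, Submodule.subset_span hab⟩ : Submodule.span K (GMFData.closedSet m L t M N)) ∈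
      Submodule.comap (Submodule.span K (GMFData.closedSet m L t M N)).subtype
        (Submodule.span K (GMFData.nullSet m L t M N)) := by
    rw [htop]; exact Submodule.mem_top
  rw [Submodule.mem_comap, Submodule.subtype_apply, span_nullSet_eq, ← SetLike.mem_coe,
    GMFData.coe_nullSub] at hmem
  exact hmem

end Field

end RigidLift

/-- **Registered helper sub-goal (H1) of `stub_rigidLift`: rigidity makes every closed cochain
null-homotopic.** For `L`-graded matrix-factorization data `M` over a field `K` with
`GMFData.IsRigid K L M` (`dim Hom(M, M(m)) = 0` in `L`-degree `0`, a `finrank` of the finite-dimensional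
space `span(closed)/span(null)`), every closed even cochain `(a, b)` of twist `m` (`aφ = φb`, `ψa = bψ`)
is null-homotopic: `a = uψ + φs`, `b = sφ + ψu` with `(s, u)` bihomogeneous of the bidegrees of
`(ψ, φ)`. This is exactly how the obstruction to lifting `M` from `𝕎ⱼ(𝕜)` to `𝕎ⱼ₊₁(𝕜)` is killed. [folklore] -/
theorem closedSet_subset_nullSet_of_isRigid : ∀ (K : Type) [Field K] (ν m : ℕ) (ι₀ ι₁ : Type)
    [Fintype ι₀] [Fintype ι₁] (L : AddSubgroup (Fin ν → ZMod m)) (M : GMFData K ν m ι₀ ι₁),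
    GMFData.IsRigid K L M →
      GMFData.closedSet m L (m : ℤ) M M ⊆ GMFData.nullSet m L (m : ℤ) M M :=
  fun _ _ _ _ _ _ _ _ L M h ↦ RigidLift.closedSet_subset_nullSet_of_homDim_eq_zero L _ M M h

end Summit.HodgeConjecture.HodgeConjecture.Cruxes.FermatAnchorAssembly.WittLiftRigidMf

end
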